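import Literature.MathematicalPhysics.QuantumFieldTheory.Balaban1983to89.T4CouplingMatching
import HarnessLib

/-!
# NE7MarginalL1Runs — route ℓ¹ of the NE7 crux, the RUN side (node U2 in ℓ¹ currency): the coupling discrepancy of two IR-pinned runs of
# (0.20) is TAIL-dominated under last-only feedback and SMEAR-dominated under GENUINE FADING MEMORY — a two-sided ℓ¹ fixed point

Cell `pub-balaban`, rung (B)+1 sub-cell t4, lineage `b2b-balaban-t4-ne7-p1`, generation 28 (CRUX PROVER NE7 #1, ruling e34b3e0c item (2)); route
ℓ¹ = `t4/ROUTES-NE7.md` §L2.1 (rank 1 → t4-ne7-p1; cell C-L1°; lens-2 sketch `t4/ideate/NE7/lens2-NE7Lens2Sketch.lean`, PRICING-NE7 v2 §9.5);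
companion `NE7MarginalL1Currency` (the shapes `TailDominated` ∕ `SmearDominated` ∕ `ShiftAlongRun` and node U6's side).  HONEST FRAMING (page 1):
FIXED FINITE T⁴, rung (B)+1; NE7 NOT PRINTED in [Balaban1984PropagatorsI]–[Balaban1989LargeFieldII], NOT PROVED here; continuum YM on T⁴ ⇐ BetaPertH
∧ nine spine estimates (0/9 proved); BetaPertH ⇐ (D1) ∧ (D4) ∧ CAP+tail; G-an2-4 gates asym, D1 and NE2/3/4; NOT infinite volume, NOT mass gap,
NOT Clay.

WHAT.  The tree's node U2 (`T4CouplingMatching` §3) bounds `disc g^A g^B j = |1∕(g^A_j)² − 1∕(g^B_{j+1})²|` of two IR-pinned runs of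
[Balaban1987RG1] (0.20) from the GEOMETRIC hypothesis `ScaleShiftRate c θ γ β` (sup over the box): `disc_le_of_lastOnly` (Markov feedback) and
`disc_le_of_fadingMemory` (history moduli, `FadingMemory C θ`).  Here the scale shift is consumed ONLY ALONG RUN B's ACTUAL HISTORY and in ℓ¹
CURRENCY — a nonnegative sequence `σ j ≥ |β_{j+1}(g^B_0..g^B_{j+1}) − β_j(g^B_1..g^B_{j+1})|`, `j < K` (the companion's `ShiftAlongRun σ β g^B K`,
written out so that this file has NO definitions) — in BOTH feedback regimes:
§1 `disc_step_along` — `disc_step` with the shift bound consumed exactly where the tree consumes `ScaleShiftRate` (lens-2 sketch, ported).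
§2 (A2, last-only; sketch, ported) **`disc_le_of_shiftAlong_lastOnly`**: `disc_j ≤ exp(2Σ_{m∈[j,K)} L(g^A_m)²g^B_{m+1})·Σ_{i∈[j,K)} σ_i` — TAIL-
   dominated; K-uniform along eventually-AF runs: **`disc_runs_le_tail_lastOnly`** (constant `exp(2L((k₀+1)γ³ + 2γ∕b))`).
§3 (A2′, NEW — genuine fading memory) `sum_Ico_sum_geom_le` (exchange of the backward accumulation against the memory), **`twoSided_fixedPoint_l1`**
   (ℓ¹ twin of `T4CouplingMatching.twoSided_fixedPoint`: `δ_j ≤ δ_{j+1} + σ_j + CΣ_{i≤j} ω^{j−i}u_iδ_i`, `Σu ≤ U`, `CU ≤ (1−ω)∕2` ⇒ `δ_j ≤ 2G_j` for ANY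
   positive weight `G` with `ω^{(j−i)₊}G_i ≤ G_j` dominating the tails of `σ`), **`disc_le_of_shiftAlong_fadingMemory`**: under `HistLipschitz Λ` +
   `FadingMemory C ω Λ` + along-run shifts + the tree's smallness, `disc_j ≤ 2·Σ_{l<K} σ_l·ω^{(j−l)₊}` — SMEAR-dominated (old scales leak in with
   weight `ω^{j−l}`; tail domination is false in general: a shift at scale 0 alone feeds every later scale through the memory); K-uniform along
   eventually-AF runs: **`disc_runs_le_smear_fadingMemory`**.
With the companion's `summable_delta_of_smearDominated` this closes the ℓ¹ road U2 → U6 under fading memory: `Σσ < ∞` ⇒ `Summable δ`.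
[folklore] bookkeeping; every hypothesis on `β` is an UNPRINTED input (cell NE4 ∕ NE9; GAPS G-t4-U2-1∕-2); 0 def, 0 sorry; nothing of
[Balaban1987RG1] asserted; NE7 NOT proved; NOT summit progress.
-/

noncomputable section

open Finset

namespace Summit.QuantumFields.BalabanUV.T4Continuum.NE7MarginalL1Runs

open Literature.MathematicalPhysics.QuantumFieldTheory.Balaban1983to89
open Literature.MathematicalPhysics.QuantumFieldTheory.Balaban1983to89.FlowStep
open T4CouplingMatching

/-! ## §1 One backward step with the shift bound consumed along run B's history -/

/-- `T4CouplingMatching.disc_step` with the scale-shift hypothesis consumed exactly where the tree lemma consumes it: a bound `s` on the β-shift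
AT RUN B's PREFIX `(g^B_0,…,g^B_{j+1})` (lens-2 sketch, ported; history moduli `Λ` arbitrary nonnegative). [cite: Balaban1987RG1, (0.20) p.256] -/
theorem disc_step_along {β : HBeta} {γ : ℝ} {Λ : ℕ → ℕ → ℝ} {K : ℕ} {gA gB : ℕ → ℝ} {s : ℝ}
    (hA : RGEqH K β gA) (hB : RGEqH (K + 1) β gB)
    (hAbox : ∀ i, i ≤ K → 0 < gA i ∧ gA i ≤ γ) (hBbox : ∀ i, i ≤ K + 1 → 0 < gB i ∧ gB i ≤ γ)
    (hL : HistLipschitz Λ γ β) (hΛ : ∀ k i, i ≤ k → 0 ≤ Λ k i) {j : ℕ} (hj : j < K)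
    (h1 : |β (j + 1) (prefixOf gB (j + 1)) - β j (Fin.tail (prefixOf gB (j + 1)))| ≤ s) :
    disc gA gB j ≤ disc gA gB (j + 1) + s + ∑ i ∈ range (j + 1), Λ j i * ((gA i) ^ 2 * gB (i + 1)) * disc gA gB i := by
  have eA := hA j hj
  have eB := hB (j + 1) (by omega)
  have hpA : prefixOf gA j ∈ Box γ j := prefixOf_mem_box hj.le hAbox
  have htail : Fin.tail (prefixOf gB (j + 1)) ∈ Box γ j := by
    rw [tail_prefixOf]
    exact prefixOf_mem_box (N := K) hj.le fun i hi => hBbox (i + 1) (by omega)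
  have h2 := hL j (Fin.tail (prefixOf gB (j + 1))) (prefixOf gA j) htail hpA
  have h3 : ∑ i : Fin (j + 1), Λ j i * |Fin.tail (prefixOf gB (j + 1)) i - prefixOf gA j i|
      ≤ ∑ i ∈ range (j + 1), Λ j i * ((gA i) ^ 2 * gB (i + 1)) * disc gA gB i := by
    rw [Finset.sum_range (fun i => Λ j i * ((gA i) ^ 2 * gB (i + 1)) * disc gA gB i)]
    refine Finset.sum_le_sum fun i _ => ?_
    have hiK : (i : ℕ) ≤ K := by have := i.isLt; omega
    have hgA := hAbox i hiK
    have hgB := hBbox (i + 1) (by omega)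
    simp only [Fin.tail, prefixOf_apply, Fin.val_succ]
    rw [abs_sub_comm, mul_assoc]
    exact mul_le_mul_of_nonneg_left (abs_sub_le_of_inv_sq hgA.1 hgB.1) (hΛ j i (Nat.lt_succ_iff.mp i.isLt))
  have key : 1 / gA j ^ 2 - 1 / gB (j + 1) ^ 2
      = (1 / gA (j + 1) ^ 2 - 1 / gB (j + 1 + 1) ^ 2)
        + (β j (prefixOf gA j) - β j (Fin.tail (prefixOf gB (j + 1))))
        - (β (j + 1) (prefixOf gB (j + 1)) - β j (Fin.tail (prefixOf gB (j + 1)))) := by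
    rw [eA, eB]
    ring
  have habs : disc gA gB j ≤ disc gA gB (j + 1)
      + |β j (prefixOf gA j) - β j (Fin.tail (prefixOf gB (j + 1)))|
      + |β (j + 1) (prefixOf gB (j + 1)) - β j (Fin.tail (prefixOf gB (j + 1)))| := by
    simp only [disc]
    rw [key]
    exact (abs_sub _ _).trans (add_le_add (abs_add_le _ _) le_rfl)
  have hcomm : |β j (prefixOf gA j) - β j (Fin.tail (prefixOf gB (j + 1)))|
      = |β j (Fin.tail (prefixOf gB (j + 1))) - β j (prefixOf gA j)| := abs_sub_comm _ _
  linarith [habs, hcomm, h1, h2, h3]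

/-! ## §2 (A2) Last-only feedback: the discrepancy is TAIL-dominated (Grönwall form, no smallness beyond `Lγ³ ≤ ½`) -/

/-- **(A2) NODE U2 IN ℓ¹ CURRENCY, MARKOV FEEDBACK** (lens-2 sketch, ported).  Two pinned runs of (0.20) (`RGEqH K β g^A`, `RGEqH (K+1) β g^B`,
couplings in `]0,γ]`, `g^A_K = g^B_{K+1}`), last-only feedback `LastOnlyLipschitz L γ β` with `Lγ³ ≤ ½`, and the β-shift bounded by `σ j` ALONG
RUN B's HISTORY for `j < K` ⇒ for `j ≤ K`, `disc g^A g^B j ≤ exp(2Σ_{m∈[j,K)} L(g^A_m)²g^B_{m+1})·Σ_{i∈[j,K)} σ_i` — the Grönwall factor times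
the TRUNCATED TAIL of `σ`; no rate `θ` anywhere (`disc_step_along` + the tree's `backward_gronwall`). [cite: Balaban1987RG1, (0.20) p.256] -/
theorem disc_le_of_shiftAlong_lastOnly {β : HBeta} {γ L : ℝ} {σ : ℕ → ℝ} {K : ℕ} {gA gB : ℕ → ℝ}
    (hL0 : 0 ≤ L) (hLγ : L * γ ^ 3 ≤ 1 / 2) (hσ0 : ∀ j, 0 ≤ σ j)
    (hA : RGEqH K β gA) (hB : RGEqH (K + 1) β gB)
    (hAbox : ∀ i, i ≤ K → 0 < gA i ∧ gA i ≤ γ) (hBbox : ∀ i, i ≤ K + 1 → 0 < gB i ∧ gB i ≤ γ)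
    (hpin : gA K = gB (K + 1))
    (hS : ∀ j, j < K → |β (j + 1) (prefixOf gB (j + 1)) - β j (Fin.tail (prefixOf gB (j + 1)))| ≤ σ j)
    (hLip : LastOnlyLipschitz L γ β) :
    ∀ j, j ≤ K → disc gA gB j ≤ Real.exp (2 * ∑ m ∈ Ico j K, L * ((gA m) ^ 2 * gB (m + 1))) * ∑ i ∈ Ico j K, σ i := by
  set Λ : ℕ → ℕ → ℝ := fun k i => if i = k then L else 0 with hΛdef
  have hHL : HistLipschitz Λ γ β := histLipschitz_of_lastOnly hLip
  have hΛ0 : ∀ k i, i ≤ k → 0 ≤ Λ k i := fun k i _ => by simp only [hΛdef]; split_ifs <;> linarith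
  set δ : ℕ → ℝ := fun j => if j ≤ K then disc gA gB j else 0 with hδdef
  set ℓ : ℕ → ℝ := fun j => if j < K then L * ((gA j) ^ 2 * gB (j + 1)) else 0 with hℓdef
  have hδ0 : ∀ j, 0 ≤ δ j := fun j => by simp only [hδdef]; split_ifs; exacts [disc_nonneg _ _ _, le_rfl]
  have hu : ∀ j, j < K → 0 ≤ (gA j) ^ 2 * gB (j + 1) ∧ (gA j) ^ 2 * gB (j + 1) ≤ γ ^ 3 := by
    intro j hj
    have hgA := hAbox j hj.le
    have hgB := hBbox (j + 1) (by omega)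
    refine ⟨mul_nonneg (sq_nonneg _) hgB.1.le, ?_⟩
    have h1 : (gA j) ^ 2 ≤ γ ^ 2 := pow_le_pow_left₀ hgA.1.le hgA.2 2
    calc (gA j) ^ 2 * gB (j + 1) ≤ γ ^ 2 * γ := mul_le_mul h1 hgB.2 hgB.1.le (sq_nonneg _)
      _ = γ ^ 3 := by ring
  have hℓ0 : ∀ j, 0 ≤ ℓ j := fun j => by simp only [hℓdef]; split_ifs with hj; exacts [mul_nonneg hL0 (hu j hj).1, le_rfl]
  have hℓ1 : ∀ j, ℓ j ≤ 1 / 2 := fun j => by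
    simp only [hℓdef]; split_ifs with hj; exacts [(mul_le_mul_of_nonneg_left (hu j hj).2 hL0).trans hLγ, by linarith]
  have hK : δ K = 0 := by simp [hδdef, disc_pin hpin]
  have hrec : ∀ j, j < K → δ j ≤ δ (j + 1) + σ j + ℓ j * δ j := by
    intro j hj
    have hstep := disc_step_along hA hB hAbox hBbox hHL hΛ0 hj (hS j hj)
    have e : ∑ i ∈ range (j + 1), Λ j i * ((gA i) ^ 2 * gB (i + 1)) * disc gA gB i
        = L * ((gA j) ^ 2 * gB (j + 1)) * disc gA gB j := by
      rw [Finset.sum_eq_single j]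
      · simp [hΛdef]
      · intro i _ hi
        simp [hΛdef, hi]
      · simp
    rw [e] at hstep
    have hδj : δ j = disc gA gB j := by simp [hδdef, hj.le]
    have hδj1 : δ (j + 1) = disc gA gB (j + 1) := by simp [hδdef, Nat.succ_le_of_lt hj]
    have hℓj : ℓ j = L * ((gA j) ^ 2 * gB (j + 1)) := by simp [hℓdef, hj]
    rw [hδj, hδj1, hℓj]
    exact hstep
  have hG := backward_gronwall hδ0 hσ0 hℓ0 hℓ1 hK hrec
  intro j hj
  have h := hG j hj
  have hδj : δ j = disc gA gB j := by simp [hδdef, hj]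
  rw [hδj] at h
  have hprod : ∏ m ∈ Ico j K, (1 + 2 * ℓ m) ≤ Real.exp (2 * ∑ m ∈ Ico j K, L * ((gA m) ^ 2 * gB (m + 1))) := by
    have e : ∑ m ∈ Ico j K, L * ((gA m) ^ 2 * gB (m + 1)) = ∑ m ∈ Ico j K, ℓ m :=
      Finset.sum_congr rfl fun m hm => by simp [hℓdef, (Finset.mem_Ico.mp hm).2]
    rw [e]
    exact prod_one_add_two_mul_le_exp hℓ0 j K
  have hsum0 : 0 ≤ ∑ i ∈ Ico j K, σ i := Finset.sum_nonneg fun i _ => hσ0 i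
  calc disc gA gB j ≤ (∏ m ∈ Ico j K, (1 + 2 * ℓ m)) * ∑ i ∈ Ico j K, σ i := h
    _ ≤ Real.exp (2 * ∑ m ∈ Ico j K, L * ((gA m) ^ 2 * gB (m + 1))) * ∑ i ∈ Ico j K, σ i :=
        mul_le_mul_of_nonneg_right hprod hsum0

/-- **(A2) FOR A FAMILY OF IR-PINNED, EVENTUALLY-AF RUNS — K-UNIFORM** (mirror of the tree's `injectedRate_of_runs_lastOnly`): runs `g K` of `K`
steps, all pinned at `gIR`, last-only feedback, `EventualLowerH b γ k₀ β`, and the β-shift bounded by `σ j` along EVERY run `g (K+1)` ⇒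
`disc (g K) (g (K+1)) j ≤ exp(2L((k₀+1)γ³ + 2γ∕b))·Σ_{i∈[j,K)} σ_i` for all `j ≤ K` — the companion's `TailDominated` with a K-free constant
(`sum_weights_le_of_eventualLower`).  Bookkeeping over UNPRINTED inputs. [cite: Balaban1987RG1, (0.20) p.256 and Thm 2 p.259] -/
theorem disc_runs_le_tail_lastOnly {β : HBeta} {γ b L : ℝ} {σ : ℕ → ℝ} {k₀ : ℕ} (g : ℕ → ℕ → ℝ) (gIR : ℝ)
    (hγ : 0 < γ) (hb : 0 < b) (hL0 : 0 ≤ L) (hLγ : L * γ ^ 3 ≤ 1 / 2) (hσ0 : ∀ j, 0 ≤ σ j)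
    (hrun : ∀ K, RGEqH K β (g K)) (hbox : ∀ K i, i ≤ K → 0 < g K i ∧ g K i ≤ γ) (hpin : ∀ K, g K K = gIR)
    (hS : ∀ K j, j < K → |β (j + 1) (prefixOf (g (K + 1)) (j + 1)) - β j (Fin.tail (prefixOf (g (K + 1)) (j + 1)))| ≤ σ j)
    (hLip : LastOnlyLipschitz L γ β) (hlo : EventualLowerH b γ k₀ β) :
    ∀ K j, j ≤ K → 0 ≤ disc (g K) (g (K + 1)) j ∧
      disc (g K) (g (K + 1)) j ≤ Real.exp (2 * (L * (((k₀ : ℝ) + 1) * γ ^ 3 + 2 * γ / b))) * ∑ i ∈ Ico j K, σ i := by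
  intro K j hj
  refine ⟨disc_nonneg _ _ _, ?_⟩
  have h := disc_le_of_shiftAlong_lastOnly hL0 hLγ hσ0 (hrun K) (hrun (K + 1)) (hbox K) (hbox (K + 1))
    ((hpin K).trans (hpin (K + 1)).symm) (hS K) hLip j hj
  have hU := sum_weights_le_of_eventualLower hγ hb (hrun K) (hrun (K + 1)) (hbox K) (hbox (K + 1)) hlo
  have hw0 : ∀ i, i ≤ K → 0 ≤ (g K i) ^ 2 * g (K + 1) (i + 1) := fun i hi =>
    mul_nonneg (sq_nonneg _) (hbox (K + 1) (i + 1) (by omega)).1.le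
  have hpart : ∑ m ∈ Ico j K, L * ((g K m) ^ 2 * g (K + 1) (m + 1)) ≤ L * (((k₀ : ℝ) + 1) * γ ^ 3 + 2 * γ / b) := by
    rw [← Finset.mul_sum]
    refine mul_le_mul_of_nonneg_left (le_trans ?_ hU) hL0
    refine Finset.sum_le_sum_of_subset_of_nonneg (fun m hm => ?_) fun i hi _ => ?_
    · exact mem_range.mpr (by have := (Finset.mem_Ico.mp hm).2; omega)
    · exact hw0 i (Nat.lt_succ_iff.mp (mem_range.mp hi))
  have hexp : Real.exp (2 * ∑ m ∈ Ico j K, L * ((g K m) ^ 2 * g (K + 1) (m + 1)))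
      ≤ Real.exp (2 * (L * (((k₀ : ℝ) + 1) * γ ^ 3 + 2 * γ / b))) := Real.exp_le_exp.mpr (by linarith)
  exact h.trans (mul_le_mul_of_nonneg_right hexp (Finset.sum_nonneg fun i _ => hσ0 i))

/-! ## §3 (A2′, NEW) Genuine fading memory: the two-sided ℓ¹ fixed point and the SMEAR-dominated discrepancy -/

/-- Partial geometric sums are bounded by `(1 − ω)⁻¹`. [folklore] -/
theorem geom_partial_le {ω : ℝ} (hω0 : 0 ≤ ω) (hω1 : ω < 1) (s : Finset ℕ) : ∑ m ∈ s, ω ^ m ≤ (1 - ω)⁻¹ :=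
  sum_le_hasSum s (fun m _ => pow_nonneg hω0 m) (hasSum_geometric_of_lt_one hω0 hω1)

/-- THE EXCHANGE LEMMA AGAINST A FADING MEMORY: for `a ≥ 0`, `0 ≤ ω < 1`,
`Σ_{m∈[j,K)} Σ_{i≤m} ω^{m−i}·a_i ≤ (1−ω)⁻¹·Σ_{i<K} ω^{(j−i)₊}·a_i` — summing the backward accumulation over `m ≥ max(i,j)` first produces the
geometric factor and leaves the weight `ω^{max(i,j)−i} = ω^{(j−i)₊}` (ℕ-subtraction). [folklore] -/
theorem sum_Ico_sum_geom_le {ω : ℝ} (hω0 : 0 ≤ ω) (hω1 : ω < 1) {a : ℕ → ℝ} (ha : ∀ i, 0 ≤ a i) (j K : ℕ) :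
    ∑ m ∈ Ico j K, ∑ i ∈ range (m + 1), ω ^ (m - i) * a i ≤ (1 - ω)⁻¹ * ∑ i ∈ range K, ω ^ (j - i) * a i := by
  have hex : ∑ m ∈ Ico j K, ∑ i ∈ range (m + 1), ω ^ (m - i) * a i
      = ∑ i ∈ range K, ∑ m ∈ Ico (max i j) K, ω ^ (m - i) * a i := by
    refine Finset.sum_comm' ?_
    intro m i
    simp only [mem_range, mem_Ico, max_le_iff]
    omega
  rw [hex, Finset.mul_sum]
  refine Finset.sum_le_sum fun i _ => ?_
  have hinner : ∑ m ∈ Ico (max i j) K, ω ^ (m - i) ≤ (1 - ω)⁻¹ * ω ^ (j - i) := by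
    rw [Finset.sum_Ico_eq_sum_range]
    have e : ∑ t ∈ range (K - max i j), ω ^ (max i j + t - i) = ω ^ (j - i) * ∑ t ∈ range (K - max i j), ω ^ t := by
      rw [Finset.mul_sum]
      refine Finset.sum_congr rfl fun t _ => ?_
      rw [← pow_add]
      congr 1
      omega
    rw [e]
    calc ω ^ (j - i) * ∑ t ∈ range (K - max i j), ω ^ t ≤ ω ^ (j - i) * (1 - ω)⁻¹ :=
          mul_le_mul_of_nonneg_left (geom_partial_le hω0 hω1 _) (pow_nonneg hω0 _)
      _ = (1 - ω)⁻¹ * ω ^ (j - i) := by ring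
  calc ∑ m ∈ Ico (max i j) K, ω ^ (m - i) * a i = (∑ m ∈ Ico (max i j) K, ω ^ (m - i)) * a i := by rw [Finset.sum_mul]
    _ ≤ (1 - ω)⁻¹ * ω ^ (j - i) * a i := mul_le_mul_of_nonneg_right hinner (ha i)
    _ = (1 - ω)⁻¹ * (ω ^ (j - i) * a i) := by ring

/-- **THE TWO-SIDED ℓ¹ FIXED POINT** (the ℓ¹ twin of `T4CouplingMatching.twoSided_fixedPoint`).  For `0 ≤ ω < 1`, `C ≥ 0`, `δ ≥ 0` with `δ_K = 0`,
weights `u_i ≥ 0` (`i ≤ K`) with `Σ_{i≤K} u_i ≤ U`, the SMALLNESS `C·U ≤ (1−ω)∕2`, sources `σ` (any sign), and the recursion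
`δ_j ≤ δ_{j+1} + σ_j + C·Σ_{i≤j} ω^{j−i}u_iδ_i` (`j < K`; unknowns on BOTH sides of `j`): for every POSITIVE weight `G` with `ω^{(j−i)₊}·G_i ≤ G_j`
for all `i, j` (antitone for `i ≥ j`, ω-smearable for `i < j`) that dominates the truncated tails (`Σ_{l∈[j,K)} σ_l ≤ G_j`, `j ≤ K`), one has
`δ_j ≤ 2·G_j` for every `j ≤ K`.  Proof: backward accumulation, the exchange lemma, the weighted maximum `M = max_{i≤K} δ_i∕G_i` on the feedback,
and the smallness absorbing `M` at the maximiser. [folklore] -/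
theorem twoSided_fixedPoint_l1 {K : ℕ} {δ u σ G : ℕ → ℝ} {ω C U : ℝ} (hω0 : 0 ≤ ω) (hω1 : ω < 1) (hC : 0 ≤ C)
    (hδ : ∀ j, 0 ≤ δ j) (hu : ∀ i, i ≤ K → 0 ≤ u i) (hU : ∑ i ∈ range (K + 1), u i ≤ U) (hsmall : C * U ≤ (1 - ω) / 2)
    (hK : δ K = 0) (hrec : ∀ j, j < K → δ j ≤ δ (j + 1) + σ j + C * ∑ i ∈ range (j + 1), ω ^ (j - i) * u i * δ i)
    (hGpos : ∀ j, 0 < G j) (hG : ∀ i j, ω ^ (j - i) * G i ≤ G j) (hGdom : ∀ j, j ≤ K → ∑ l ∈ Ico j K, σ l ≤ G j) :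
    ∀ j, j ≤ K → δ j ≤ 2 * G j := by
  have hne : (range (K + 1)).Nonempty := ⟨0, by simp⟩
  set M := (range (K + 1)).sup' hne (fun i => δ i / G i) with hM
  have hMi : ∀ i, i ≤ K → δ i ≤ M * G i := by
    intro i hi
    have h : δ i / G i ≤ M := Finset.le_sup' (fun i => δ i / G i) (mem_range.mpr (Nat.lt_succ_of_le hi))
    rwa [div_le_iff₀ (hGpos i)] at h
  have hM0 : 0 ≤ M := by
    have h : δ 0 / G 0 ≤ M := Finset.le_sup' (fun i => δ i / G i) (mem_range.mpr (Nat.succ_pos K))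
    exact (div_nonneg (hδ 0) (hGpos 0).le).trans h
  have hU0 : 0 ≤ U := (Finset.sum_nonneg fun i hi => hu i (Nat.lt_succ_iff.mp (mem_range.mp hi))).trans hU
  have h1ω : 0 < 1 - ω := by linarith
  -- backward accumulation of the recursion
  have hacc : ∀ j, j ≤ K → δ j ≤ ∑ m ∈ Ico j K, (σ m + C * ∑ i ∈ range (m + 1), ω ^ (m - i) * u i * δ i) :=
    backward_sum (le_of_eq hK) fun j hj => by linarith [hrec j hj]
  -- the feedback, exchanged against the memory and bounded through the weighted maximum
  have hfb : ∀ j, j ≤ K → ∑ m ∈ Ico j K, C * ∑ i ∈ range (m + 1), ω ^ (m - i) * u i * δ i ≤ C * (1 - ω)⁻¹ * (M * U) * G j := by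
    intro j hj
    have ha : ∀ i, 0 ≤ (if i ≤ K then u i * δ i else 0) := fun i => by
      split_ifs with h; exacts [mul_nonneg (hu i h) (hδ i), le_rfl]
    have hex := sum_Ico_sum_geom_le hω0 hω1 ha j K
    have e1 : ∑ m ∈ Ico j K, C * ∑ i ∈ range (m + 1), ω ^ (m - i) * u i * δ i
        = C * ∑ m ∈ Ico j K, ∑ i ∈ range (m + 1), ω ^ (m - i) * (if i ≤ K then u i * δ i else 0) := by
      rw [Finset.mul_sum]
      refine Finset.sum_congr rfl fun m hm => ?_
      congr 1
      refine Finset.sum_congr rfl fun i hi => ?_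
      have hiK : i ≤ K := by have := mem_range.mp hi; have := (mem_Ico.mp hm).2; omega
      rw [if_pos hiK, mul_assoc]
    have e2 : ∑ i ∈ range K, ω ^ (j - i) * (if i ≤ K then u i * δ i else 0) ≤ M * U * G j := by
      calc ∑ i ∈ range K, ω ^ (j - i) * (if i ≤ K then u i * δ i else 0)
          = ∑ i ∈ range K, ω ^ (j - i) * (u i * δ i) :=
            Finset.sum_congr rfl fun i hi => by rw [if_pos (mem_range.mp hi).le]
        _ ≤ ∑ i ∈ range K, u i * (M * G j) := by
            refine Finset.sum_le_sum fun i hi => ?_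
            have hiK : i ≤ K := (mem_range.mp hi).le
            calc ω ^ (j - i) * (u i * δ i) ≤ ω ^ (j - i) * (u i * (M * G i)) :=
                  mul_le_mul_of_nonneg_left (mul_le_mul_of_nonneg_left (hMi i hiK) (hu i hiK)) (pow_nonneg hω0 _)
              _ = u i * (M * (ω ^ (j - i) * G i)) := by ring
              _ ≤ u i * (M * G j) := mul_le_mul_of_nonneg_left (mul_le_mul_of_nonneg_left (hG i j) hM0) (hu i hiK)
        _ = (∑ i ∈ range K, u i) * (M * G j) := by rw [Finset.sum_mul]
        _ ≤ U * (M * G j) := by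
            refine mul_le_mul_of_nonneg_right ?_ (mul_nonneg hM0 (hGpos j).le)
            exact le_trans (Finset.sum_le_sum_of_subset_of_nonneg (Finset.range_mono (Nat.le_succ K))
              fun i hi _ => hu i (Nat.lt_succ_iff.mp (mem_range.mp hi))) hU
        _ = M * U * G j := by ring
    rw [e1]
    have hC' : 0 ≤ C * (1 - ω)⁻¹ := mul_nonneg hC (inv_nonneg.mpr h1ω.le)
    calc C * ∑ m ∈ Ico j K, ∑ i ∈ range (m + 1), ω ^ (m - i) * (if i ≤ K then u i * δ i else 0)
        ≤ C * ((1 - ω)⁻¹ * ∑ i ∈ range K, ω ^ (j - i) * (if i ≤ K then u i * δ i else 0)) := mul_le_mul_of_nonneg_left hex hC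
      _ = C * (1 - ω)⁻¹ * ∑ i ∈ range K, ω ^ (j - i) * (if i ≤ K then u i * δ i else 0) := by ring
      _ ≤ C * (1 - ω)⁻¹ * (M * U * G j) := mul_le_mul_of_nonneg_left e2 hC'
      _ = C * (1 - ω)⁻¹ * (M * U) * G j := by ring
  -- hence the a-priori bound through M
  have hb : ∀ j, j ≤ K → δ j ≤ (1 + C * (1 - ω)⁻¹ * (M * U)) * G j := by
    intro j hj
    have h := hacc j hj
    rw [Finset.sum_add_distrib] at h
    have := hGdom j hj
    have := hfb j hj
    linarith
  -- at the maximiser the smallness absorbs M: M ≤ 2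
  obtain ⟨i₀, hi₀, hMi₀⟩ := Finset.exists_mem_eq_sup' hne (fun i => δ i / G i)
  have hi₀K : i₀ ≤ K := Nat.lt_succ_iff.mp (mem_range.mp hi₀)
  have hMle : M ≤ 1 + C * (1 - ω)⁻¹ * (M * U) := by
    have h := hb i₀ hi₀K
    calc M = δ i₀ / G i₀ := hMi₀
      _ ≤ 1 + C * (1 - ω)⁻¹ * (M * U) := by rw [div_le_iff₀ (hGpos i₀)]; exact h
  have hq : C * (1 - ω)⁻¹ * U ≤ 1 / 2 := by
    rw [mul_comm C, mul_assoc, inv_mul_le_iff₀ h1ω]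
    linarith
  have hMfin : M ≤ 2 := by
    have : C * (1 - ω)⁻¹ * (M * U) = (C * (1 - ω)⁻¹ * U) * M := by ring
    rw [this] at hMle
    nlinarith [hq, hM0, mul_le_mul_of_nonneg_right hq hM0]
  intro j hj
  calc δ j ≤ M * G j := hMi j hj
    _ ≤ 2 * G j := mul_le_mul_of_nonneg_right hMfin (hGpos j).le

/-- Monotonicity of powers of `ω ∈ [0,1]` along the triangle inequality of ℕ-subtraction: `ω^{(j−i)₊}·ω^{(i−l)₊} ≤ ω^{(j−l)₊}`. [folklore] -/
theorem pow_tsub_mul_pow_tsub_le {ω : ℝ} (hω0 : 0 ≤ ω) (hω1 : ω ≤ 1) (i j l : ℕ) : ω ^ (j - i) * ω ^ (i - l) ≤ ω ^ (j - l) := by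
  rw [← pow_add]
  exact pow_le_pow_of_le_one hω0 hω1 (by omega)

/-- **(A2′) NODE U2 IN ℓ¹ CURRENCY UNDER GENUINE FADING MEMORY.**  Two pinned runs of (0.20) as in §2; history moduli `HistLipschitz Λ γ β` with
`FadingMemory C ω Λ` (`0 < ω < 1`, `C ≥ 0`); the AF window `Σ_{i≤K} (g^A_i)²g^B_{i+1} ≤ U` with the tree's smallness `C·U ≤ (1−ω)∕2`; and the
β-shift bounded by `σ j ≥ 0` ALONG RUN B's HISTORY for `j < K`.  THEN for `j ≤ K`:
`disc g^A g^B j ≤ 2·Σ_{l<K} σ_l·ω^{(j−l)₊}` — the ω-SMEARED tail (the companion's `SmearDominated 2 ω σ`): weight `1` on the scales `l ≥ j`, weight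
`ω^{j−l}` on the older ones.  (`twoSided_fixedPoint_l1` with the weight `G_j = Σ_{l<K} σ_lω^{(j−l)₊} + τω^j`, `τ ↓ 0`.)  Every hypothesis on `β` is an
UNPRINTED input (cell NE4∕NE9). [cite: Balaban1987RG1, (0.20) p.256 and §5 p.298] -/
theorem disc_le_of_shiftAlong_fadingMemory {β : HBeta} {γ ω C U : ℝ} {Λ : ℕ → ℕ → ℝ} {σ : ℕ → ℝ} {K : ℕ} {gA gB : ℕ → ℝ}
    (hω0 : 0 < ω) (hω1 : ω < 1) (hC : 0 ≤ C) (hσ0 : ∀ j, 0 ≤ σ j)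
    (hA : RGEqH K β gA) (hB : RGEqH (K + 1) β gB)
    (hAbox : ∀ i, i ≤ K → 0 < gA i ∧ gA i ≤ γ) (hBbox : ∀ i, i ≤ K + 1 → 0 < gB i ∧ gB i ≤ γ)
    (hpin : gA K = gB (K + 1))
    (hS : ∀ j, j < K → |β (j + 1) (prefixOf gB (j + 1)) - β j (Fin.tail (prefixOf gB (j + 1)))| ≤ σ j)
    (hL : HistLipschitz Λ γ β) (hΛ : FadingMemory C ω Λ)
    (hU : ∑ i ∈ range (K + 1), (gA i) ^ 2 * gB (i + 1) ≤ U) (hsmall : C * U ≤ (1 - ω) / 2) :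
    ∀ j, j ≤ K → disc gA gB j ≤ 2 * ∑ l ∈ range K, σ l * ω ^ (j - l) := by
  have hu : ∀ i, i ≤ K → 0 ≤ (gA i) ^ 2 * gB (i + 1) := fun i hi => mul_nonneg (sq_nonneg _) (hBbox (i + 1) (by omega)).1.le
  -- the recursion with the fading-memory bound on the feedback
  have hrec : ∀ j, j < K → disc gA gB j ≤ disc gA gB (j + 1) + σ j
      + C * ∑ i ∈ range (j + 1), ω ^ (j - i) * ((gA i) ^ 2 * gB (i + 1)) * disc gA gB i := by
    intro j hj
    have hstep := disc_step_along hA hB hAbox hBbox hL (fun k i hik => (hΛ k i hik).1) hj (hS j hj)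
    have hsum : ∑ i ∈ range (j + 1), Λ j i * ((gA i) ^ 2 * gB (i + 1)) * disc gA gB i
        ≤ C * ∑ i ∈ range (j + 1), ω ^ (j - i) * ((gA i) ^ 2 * gB (i + 1)) * disc gA gB i := by
      rw [Finset.mul_sum]
      refine Finset.sum_le_sum fun i hi => ?_
      have hij : i ≤ j := Nat.lt_succ_iff.mp (mem_range.mp hi)
      have hnn : 0 ≤ (gA i) ^ 2 * gB (i + 1) * disc gA gB i := mul_nonneg (hu i (by omega)) (disc_nonneg _ _ _)
      calc Λ j i * ((gA i) ^ 2 * gB (i + 1)) * disc gA gB i = Λ j i * ((gA i) ^ 2 * gB (i + 1) * disc gA gB i) := by ring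
        _ ≤ C * ω ^ (j - i) * ((gA i) ^ 2 * gB (i + 1) * disc gA gB i) := mul_le_mul_of_nonneg_right (hΛ j i hij).2 hnn
        _ = C * (ω ^ (j - i) * ((gA i) ^ 2 * gB (i + 1)) * disc gA gB i) := by ring
    linarith [hstep, hsum]
  -- the smeared tail plus a positive geometric regulariser is an admissible weight
  set S : ℕ → ℝ := fun j => ∑ l ∈ range K, σ l * ω ^ (j - l) with hSdef
  have hS0 : ∀ j, 0 ≤ S j := fun j => Finset.sum_nonneg fun l _ => mul_nonneg (hσ0 l) (pow_nonneg hω0.le _)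
  have hSsm : ∀ i j, ω ^ (j - i) * S i ≤ S j := by
    intro i j
    simp only [hSdef]
    rw [Finset.mul_sum]
    refine Finset.sum_le_sum fun l _ => ?_
    calc ω ^ (j - i) * (σ l * ω ^ (i - l)) = σ l * (ω ^ (j - i) * ω ^ (i - l)) := by ring
      _ ≤ σ l * ω ^ (j - l) := mul_le_mul_of_nonneg_left (pow_tsub_mul_pow_tsub_le hω0.le hω1.le i j l) (hσ0 l)
  have hSdom : ∀ j, j ≤ K → ∑ l ∈ Ico j K, σ l ≤ S j := by
    intro j hj
    simp only [hSdef]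
    calc ∑ l ∈ Ico j K, σ l = ∑ l ∈ Ico j K, σ l * ω ^ (j - l) := Finset.sum_congr rfl fun l hl => by
          have : j - l = 0 := by have := (mem_Ico.mp hl).1; omega
          simp [this]
      _ ≤ ∑ l ∈ range K, σ l * ω ^ (j - l) :=
          Finset.sum_le_sum_of_subset_of_nonneg (fun l hl => mem_range.mpr (mem_Ico.mp hl).2)
            fun l _ _ => mul_nonneg (hσ0 l) (pow_nonneg hω0.le _)
  have hmain : ∀ τ, 0 < τ → ∀ j, j ≤ K → disc gA gB j ≤ 2 * S j + 2 * τ := by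
    intro τ hτ j hj
    have hGpos : ∀ j, 0 < S j + τ * ω ^ j := fun j => add_pos_of_nonneg_of_pos (hS0 j) (mul_pos hτ (pow_pos hω0 j))
    have hG : ∀ i j, ω ^ (j - i) * (S i + τ * ω ^ i) ≤ S j + τ * ω ^ j := by
      intro i j
      have h2 : ω ^ (j - i) * ω ^ i ≤ ω ^ j := by
        rw [← pow_add]
        exact pow_le_pow_of_le_one hω0.le hω1.le (by omega)
      have := hSsm i j
      nlinarith [mul_le_mul_of_nonneg_left h2 hτ.le]
    have hGdom : ∀ j, j ≤ K → ∑ l ∈ Ico j K, σ l ≤ S j + τ * ω ^ j := fun j hj =>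
      (hSdom j hj).trans (le_add_of_nonneg_right (mul_nonneg hτ.le (pow_nonneg hω0.le _)))
    have h := twoSided_fixedPoint_l1 (δ := disc gA gB) (u := fun i => (gA i) ^ 2 * gB (i + 1)) hω0.le hω1 hC
      (disc_nonneg gA gB) hu hU hsmall (disc_pin hpin) hrec hGpos hG hGdom j hj
    have hωj : ω ^ j ≤ 1 := pow_le_one₀ hω0.le hω1.le
    nlinarith [h, hωj, hτ]
  intro j hj
  refine le_of_forall_pos_le_add fun ε hε => ?_
  have := hmain (ε / 2) (by positivity) j hj
  linarith

/-- **(A2′) FOR A FAMILY OF IR-PINNED, EVENTUALLY-AF RUNS — K-UNIFORM** (mirror of the tree's `injectedRate_of_runs_eventual`): runs `g K` pinned at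
`gIR`, `HistLipschitz Λ γ β`, `FadingMemory C ω Λ` (`0 < ω < 1`), `EventualLowerH b γ k₀ β` with the smallness `C((k₀+1)γ³ + 2γ∕b) ≤ (1−ω)∕2`, and
the β-shift bounded by `σ j` along every run `g (K+1)` ⇒ `disc (g K) (g (K+1)) j ≤ 2·Σ_{l<K} σ_lω^{(j−l)₊}` for all `j ≤ K` — the companion's
`SmearDominated 2 ω σ`.  Bookkeeping over UNPRINTED inputs. [cite: Balaban1987RG1, (0.20) p.256 and Thm 2 p.259] -/
theorem disc_runs_le_smear_fadingMemory {β : HBeta} {γ b ω C : ℝ} {Λ : ℕ → ℕ → ℝ} {σ : ℕ → ℝ} {k₀ : ℕ} (g : ℕ → ℕ → ℝ) (gIR : ℝ)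
    (hγ : 0 < γ) (hb : 0 < b) (hω0 : 0 < ω) (hω1 : ω < 1) (hC : 0 ≤ C) (hσ0 : ∀ j, 0 ≤ σ j)
    (hrun : ∀ K, RGEqH K β (g K)) (hbox : ∀ K i, i ≤ K → 0 < g K i ∧ g K i ≤ γ) (hpin : ∀ K, g K K = gIR)
    (hS : ∀ K j, j < K → |β (j + 1) (prefixOf (g (K + 1)) (j + 1)) - β j (Fin.tail (prefixOf (g (K + 1)) (j + 1)))| ≤ σ j)
    (hL : HistLipschitz Λ γ β) (hΛ : FadingMemory C ω Λ) (hlo : EventualLowerH b γ k₀ β)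
    (hsmall : C * (((k₀ : ℝ) + 1) * γ ^ 3 + 2 * γ / b) ≤ (1 - ω) / 2) :
    ∀ K j, j ≤ K → 0 ≤ disc (g K) (g (K + 1)) j ∧ disc (g K) (g (K + 1)) j ≤ 2 * ∑ l ∈ range K, σ l * ω ^ (j - l) := by
  intro K j hj
  refine ⟨disc_nonneg _ _ _, ?_⟩
  exact disc_le_of_shiftAlong_fadingMemory hω0 hω1 hC hσ0 (hrun K) (hrun (K + 1)) (hbox K) (hbox (K + 1))
    ((hpin K).trans (hpin (K + 1)).symm) (hS K) hL hΛ
    (sum_weights_le_of_eventualLower hγ hb (hrun K) (hrun (K + 1)) (hbox K) (hbox (K + 1)) hlo) hsmall j hj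

end Summit.QuantumFields.BalabanUV.T4Continuum.NE7MarginalL1Runs

end
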